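/-
Copyright (c) 2026. Released under Apache 2.0 license as described in the file LICENSE.
-/
import Summits.RiemannHypothesis.RiemannHypothesis.Theorems.LiDirichletKernelMainTerm
import Literature.Analysis.SpecialFunctions.LogPiBounds
import Literature.NumberTheory.Sieve.LevelOfDistributionProofs
import HarnessLib

/-!
# KERNEL LINEAGE K-χ — the Dirichlet leaf's inequality on the WHOLE certified range `1 ≤ n ≤ 48`

RH-FREE DATA + RH-free constants (0 kit).  bears_on: LADDER-RH L-D (COLUMN 4 LI, DATA rung; Dirichlet rows) → the
leaf `LiTheory.LiDirichletAsymptoticLaw`.  WHAT THIS IS NOT: not the leaf (which is about `n ≥ 900` under GRH to height),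
not evidence for GRH; nothing here bears on the truth of RH/GRH.

`LiDirichletKernelMainTerm` proved `|Re λ_χ(n) − charLiMainTerm q n| < √n log(qn)` for `3 ≤ n ≤ 48` from `|lt_χ(n)| < √n`
and the trend theorems.  The two remaining rows `n = 1, 2` need the constant `C₁ = liC1 = (γ − 1 − log 2π)/2`: here
`−1.1304 < C₁ < −1.1302` (`liC1_gt_d4`, `liC1_lt_d4`) from the kernel's `γ` (`LiKernel.eulerMascheroniConstant_gt_d49 /
_lt_d47`), Mathlib's `Real.log_two_gt_d9 / _lt_d9` and the tree's `Literature.Analysis.SpecialFunctions.Real.log_pi_gt_d20 /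
_lt_d20` (`LogPiBounds`); the
certified `λ`-rows `1, 2` of the 23 tables are tested against per-conductor thresholds (`smallOK`, one `decide`, with
`log q ≥ 1, 2 log 2, 3 log 2` for `q ≥ 3, 4, 8`).  Result `abs_liCoeffCharRe_sub_charLiMainTerm_lt_of_le_48`: the leaf's
BMOR-form inequality holds UNCONDITIONALLY for EVERY `1 ≤ n ≤ 48` and every primitive `χ` of conductor `2 ≤ q ≤ 13`.
-/

set_option linter.dupNamespace false

namespace Summit.RiemannHypothesis.RiemannHypothesis.Theorems.LiDirichletKernel

open Literature.NumberTheory.LFunctions Literature.NumberTheory.LFunctions.LiDirichlet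
open Summit.RiemannHypothesis.RiemannHypothesis.Theorems.LiTheory

/-! ## The constant `C₁` to four digits -/

/-- `log 2π = log 2 + log π ∈ (1.8378770661, 1.8378770667)` (nine-digit `log 2`, twenty-digit `log π`). -/
theorem log_two_pi_bounds : (1.8378770661 : ℝ) < Real.log (2 * Real.pi) ∧ Real.log (2 * Real.pi) < 1.8378770667 := by
  rw [Real.log_mul (by norm_num) Real.pi_pos.ne']
  have h1 := Real.log_two_gt_d9
  have h2 := Real.log_two_lt_d9
  have h3 := Literature.Analysis.SpecialFunctions.Real.log_pi_gt_d20
  have h4 := Literature.Analysis.SpecialFunctions.Real.log_pi_lt_d20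
  constructor <;> linarith

/-- `C₁ = (γ − 1 − log 2π)/2 > −1.1304` (`γ > 0.5772`, `log 2π < 1.83788`). -/
theorem liC1_gt_d4 : (-1.1304 : ℝ) < liC1 := by
  have hγ := Summit.RiemannHypothesis.RiemannHypothesis.Theorems.LiKernel.eulerMascheroniConstant_gt_d49
  have h := log_two_pi_bounds.2
  unfold liC1
  linarith

/-- `C₁ < −1.1302`. -/
theorem liC1_lt_d4 : liC1 < (-1.1302 : ℝ) := by
  have hγ := Summit.RiemannHypothesis.RiemannHypothesis.Theorems.LiKernel.eulerMascheroniConstant_lt_d47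
  have h := log_two_pi_bounds.1
  unfold liC1
  linarith

/-! ## Lower bounds for `log q` -/

/-- `1.3862 ≤ log x` for `x ≥ 4` (`log 4 = 2 log 2`). -/
theorem log_ge_of_four_le {x : ℝ} (hx : 4 ≤ x) : (1.3862 : ℝ) ≤ Real.log x := by
  have h4 : Real.log 4 = 2 * Real.log 2 := by
    rw [show (4 : ℝ) = 2 ^ 2 by norm_num, Real.log_pow]; norm_num
  have h := Real.log_le_log (by norm_num) hx
  linarith [Real.log_two_gt_d9]

/-- `2.0794 ≤ log x` for `x ≥ 8` (`log 8 = 3 log 2`). -/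
theorem log_ge_of_eight_le {x : ℝ} (hx : 8 ≤ x) : (2.0794 : ℝ) ≤ Real.log x := by
  have h8 : Real.log 8 = 3 * Real.log 2 := by
    rw [show (8 : ℝ) = 2 ^ 3 by norm_num, Real.log_pow]; norm_num
  have h := Real.log_le_log (by norm_num) hx
  linarith [Real.log_two_gt_d9]

/-- The lower bound for `log q` used at conductor `q`: `1` (`q < 4`), `1.3862` (`4 ≤ q < 8`), `2.0794` (`q ≥ 8`). -/
noncomputable def logLB (q : ℕ) : ℝ := if q < 4 then 1 else if q < 8 then 1.3862 else 2.0794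

/-- `logLB q ≤ log q` for `q ≥ 3`. -/
theorem logLB_le_log {q : ℕ} (hq : 3 ≤ q) : logLB q ≤ Real.log q := by
  unfold logLB
  split_ifs with h4 h8
  · exact Literature.NumberTheory.Sieve.one_le_log_of_three_le (by exact_mod_cast hq)
  · exact log_ge_of_four_le (by exact_mod_cast (show 4 ≤ q by omega))
  · exact log_ge_of_eight_le (by exact_mod_cast (show 8 ≤ q by omega))

/-! ## The row checks at `n = 1, 2` -/

/-- Integer thresholds `A₁(q) = 10⁴·(−1.1304 + 1.5·logLB q)` and `A₂(q) = ⌊10⁴·(−0.58741798 + 2.4142·logLB q)⌋`. -/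
def thrA1 (q : ℕ) : ℤ := if q < 4 then 3696 else if q < 8 then 9489 else 19887

/-- `A₂(q) = ⌊10⁴·(−0.58741798 + 2.4142·logLB q)⌋` (threshold for the `λ`-row `2`; see `thrA1`). -/
def thrA2 (q : ℕ) : ℤ := if q < 4 then 18267 else if q < 8 then 27591 else 44326

/-- `λ.hi(1)·10⁴ < A₁(q)·10^{d₁}` and `λ.hi(2)·10⁴ < A₂(q)·10^{d₂}`. -/
def smallOK (A1 A2 : ℤ) (rows : RowTable) : Bool :=
  decide ((rowOf rows 1).2.2.1 * 10000 < A1 * 10 ^ (rowOf rows 1).1)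
    && decide ((rowOf rows 2).2.2.1 * 10000 < A2 * 10 ^ (rowOf rows 2).1)

/-- All 23 tables pass the `n = 1, 2` checks for their conductor. -/
def allSmallOK : Bool := (List.range 14).all fun q ↦ (classRows q).all (smallOK (thrA1 q) (thrA2 q))

/-- Kernel evaluation. -/
theorem allSmallOK_true : allSmallOK = true := by decide +kernel

/-- Reading a threshold check: `x ≤ h/10^d` and `h·10⁴ < A·10^d` give `x < A/10⁴`. -/
theorem lt_of_hi_check {x : ℝ} {d : ℕ} {l h A : ℤ} (hx : InRow x d l h) (hA : h * 10000 < A * 10 ^ d) :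
    x < (A : ℝ) / 10000 := by
  have h1 : (h : ℝ) / 10 ^ d < (A : ℝ) / 10000 := by
    rw [div_lt_div_iff₀ (by positivity) (by positivity)]
    exact_mod_cast hA
  exact hx.2.trans_lt h1

/-- The two `λ`-row bounds of a primitive character at `n = 1, 2`. -/
theorem liCoeffCharRe_one_two_lt {q : ℕ} [NeZero q] (hq : 2 ≤ q) (hq' : q ≤ 13) (χ : DirichletCharacter ℂ q)
    (hprim : χ.IsPrimitive) :
    liCoeffCharRe χ 1 < (thrA1 q : ℝ) / 10000 ∧ liCoeffCharRe χ 2 < (thrA2 q : ℝ) / 10000 := by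
  obtain ⟨rows, hmem, hrows⟩ := exists_classRows_of_isPrimitive hq hq' χ hprim
  have hall := allSmallOK_true
  unfold allSmallOK at hall
  rw [List.all_eq_true] at hall
  have h1 := hall q (List.mem_range.2 (by omega))
  rw [List.all_eq_true] at h1
  have h2 := h1 rows hmem
  simp only [smallOK, Bool.and_eq_true, decide_eq_true_eq] at h2
  exact ⟨lt_of_hi_check (hrows.mem 1 le_rfl (by norm_num)).1 h2.1, lt_of_hi_check (hrows.mem 2 (by norm_num) (by norm_num)).1 h2.2⟩

/-! ## The leaf's inequality at `n = 1, 2` and on the whole range -/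

/-- `n = 1`: `|Re λ_χ(1) − (C₁ + ½ log q)| < log q` (conductor `2 ≤ q ≤ 13`, `χ` primitive).  RH-FREE DATA. -/
theorem abs_liCoeffCharRe_one_sub_charLiMainTerm_lt {q : ℕ} [NeZero q] (hq : 2 ≤ q) (hq' : q ≤ 13)
    (χ : DirichletCharacter ℂ q) (hprim : χ.IsPrimitive) :
    |liCoeffCharRe χ 1 - charLiMainTerm q 1| < Real.sqrt (1 : ℕ) * Real.log ((q : ℝ) * (1 : ℕ)) := by
  rcases (show q = 2 ∨ 3 ≤ q by omega) with rfl | hq3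
  · obtain ⟨rows, hmem, -⟩ := exists_classRows_of_isPrimitive hq hq' χ hprim
    simp [classRows] at hmem
  have hpos := liCoeffCharRe_pos_of_isPrimitive_le_13 hq hq' χ hprim (n := 1) le_rfl (by norm_num)
  have hup := (liCoeffCharRe_one_two_lt hq hq' χ hprim).1
  have hL := logLB_le_log hq3
  have hC1 := liC1_gt_d4
  have hC1' := liC1_lt_d4
  have hA : ((thrA1 q : ℤ) : ℝ) / 10000 = -1.1304 + 3 / 2 * logLB q := by
    unfold thrA1 logLB; split_ifs <;> norm_num
  have hmain : charLiMainTerm q 1 = liC1 + 1 / 2 * Real.log q := by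
    simp [charLiMainTerm, liMainTerm]
  have hlogq : 0 < Real.log q := by linarith [Literature.NumberTheory.Sieve.one_le_log_of_three_le (show (3 : ℝ) ≤ q by exact_mod_cast hq3)]
  rw [Nat.cast_one, Real.sqrt_one, one_mul, mul_one, hmain, abs_lt]
  rw [hA] at hup
  constructor <;> linarith

/-- `n = 2`: `|Re λ_χ(2) − (log 2 + 2C₁ + log q)| < √2 log(2q)` (conductor `2 ≤ q ≤ 13`, `χ` primitive).  RH-FREE DATA. -/
theorem abs_liCoeffCharRe_two_sub_charLiMainTerm_lt {q : ℕ} [NeZero q] (hq : 2 ≤ q) (hq' : q ≤ 13)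
    (χ : DirichletCharacter ℂ q) (hprim : χ.IsPrimitive) :
    |liCoeffCharRe χ 2 - charLiMainTerm q 2| < Real.sqrt (2 : ℕ) * Real.log ((q : ℝ) * (2 : ℕ)) := by
  rcases (show q = 2 ∨ 3 ≤ q by omega) with rfl | hq3
  · obtain ⟨rows, hmem, -⟩ := exists_classRows_of_isPrimitive hq hq' χ hprim
    simp [classRows] at hmem
  have hpos := liCoeffCharRe_pos_of_isPrimitive_le_13 hq hq' χ hprim (n := 2) (by norm_num) (by norm_num)
  have hup := (liCoeffCharRe_one_two_lt hq hq' χ hprim).2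
  have hL := logLB_le_log hq3
  have hC1 := liC1_gt_d4
  have hC1' := liC1_lt_d4
  have hl2 := Real.log_two_gt_d9
  have hl2' := Real.log_two_lt_d9
  have hA : ((thrA2 q : ℤ) : ℝ) / 10000 ≤ -0.58741798 + 2.4142 * logLB q := by
    unfold thrA2 logLB; split_ifs <;> norm_num
  have hmain : charLiMainTerm q 2 = Real.log 2 + 2 * liC1 + Real.log q := by
    simp [charLiMainTerm, liMainTerm]; ring
  have hq0 : (0 : ℝ) < q := by exact_mod_cast (show 0 < q by omega)
  have hlogq : 1 ≤ Real.log q := Literature.NumberTheory.Sieve.one_le_log_of_three_le (show (3 : ℝ) ≤ q by exact_mod_cast hq3)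
  have hlog2q : Real.log ((q : ℝ) * (2 : ℕ)) = Real.log q + Real.log 2 := by
    rw [Nat.cast_ofNat, Real.log_mul hq0.ne' (by norm_num)]
  have hsqrt : (1.4142 : ℝ) ≤ Real.sqrt (2 : ℕ) := by
    rw [Nat.cast_ofNat, Real.le_sqrt (by norm_num) (by norm_num)]; norm_num
  have hprod : (1.4142 : ℝ) * (Real.log q + Real.log 2) ≤ Real.sqrt (2 : ℕ) * (Real.log q + Real.log 2) :=
    mul_le_mul_of_nonneg_right hsqrt (by linarith)
  rw [hmain, hlog2q, abs_lt]
  -- keep `√2 · (log q + log 2)` as ONE atom for `linarith` (the `ℕ`-cast inside `√↑2` otherwise splits it)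
  set P := Real.sqrt (2 : ℕ) * (Real.log q + Real.log 2) with hP
  constructor
  · linarith
  · linarith

/-- **THE LEAF'S INEQUALITY ON THE WHOLE CERTIFIED RANGE**: `|Re λ_χ(n) − charLiMainTerm q n| < √n log(qn)` for every
primitive character of conductor `2 ≤ q ≤ 13` and EVERY `1 ≤ n ≤ 48` — UNCONDITIONAL (kernel-certified table + RH-free trend
theorems + four-digit constants); the leaf `LiDirichletAsymptoticLaw` asserts this shape for `n ≥ 900` under GRH to height
`2√n` and BMOR.  RH-FREE DATA; not the leaf, not evidence for GRH. -/
theorem abs_liCoeffCharRe_sub_charLiMainTerm_lt_of_le_48 {q : ℕ} [NeZero q] (hq : 2 ≤ q) (hq' : q ≤ 13)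
    (χ : DirichletCharacter ℂ q) (hprim : χ.IsPrimitive) {n : ℕ} (hn : 1 ≤ n) (hn' : n ≤ 48) :
    |liCoeffCharRe χ n - charLiMainTerm q n| < Real.sqrt n * Real.log ((q : ℝ) * n) := by
  rcases (show n = 1 ∨ n = 2 ∨ 3 ≤ n by omega) with rfl | rfl | h3
  · exact abs_liCoeffCharRe_one_sub_charLiMainTerm_lt hq hq' χ hprim
  · exact abs_liCoeffCharRe_two_sub_charLiMainTerm_lt hq hq' χ hprim
  · exact abs_liCoeffCharRe_sub_charLiMainTerm_lt hq hq' χ hprim h3 hn'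

end Summit.RiemannHypothesis.RiemannHypothesis.Theorems.LiDirichletKernel
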